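import Literature.Probability.RandomPlanarGeometry.HexSAWPolygonCellsChain3
import Literature.Probability.RandomPlanarGeometry.HexSAWPolygonCellsRun
import Literature.Probability.RandomPlanarGeometry.HexSAWPolygonCellsOmegaRec
import HarnessLib

/-!
# Cell calculus for honeycomb polygon surgery, XXV: base data for the exceptional base `C₂ ↦ F₂`, and the idle exceptional host of a type-R base (LEMMA X)

Topic `Literature/Probability/RandomPlanarGeometry` (lane «pcv-sawmu», a-p4 g22; sequel of XVI `…CellsChain3` (`perim_F2`, `card_contacts_portF2`), XIII
`…CellsRun` (`runLen`), XXII `…CellsOmegaRec` (`PortInv`), XII `…CellsStickDecomp`, VIII `…CellsDiag` (`IsHost.lowRow_ge_of_run`), XIX `…CellsPolygonMoves`).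

* ★ `portInv_F2` — `PortInv ∅ C₂ F₂ (fun _ ↦ UR (UL (UR p)))` for the 3-chain `C₂ = {p, UR p, UR² p}` (a brick `p`): its only host is the top `UR² p`
  (`isHost_chain3_iff`), whose port in `F₂ = {p, R p, UR p, UL (UR p)}` is the clean spot `(p.x+1, p.y+3)` with a clear ray.
* ★ `isPolygon_bdry_F2` — if `bdry C₂` is a polygon then so is `bdry F₂` (peel the top spike, insert `R p` with contact arc `{UL, L}`, insert `UL (UR p)` with
  contact arc `{LR}`: XIX).
* ★ LEMMA X `ur_lastRun_notMem` — if `peel S` is of type R at its top `t` (`L t ∉ peel S`) with run length `k ≥ 2`, then the spike spot `UR e_{k−1}` over the last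
  run hexagon is NOT in `S` (otherwise, when it was peeled, the rest was exactly the base — every other peeled hexagon lies above it by XII + III + VIII — and the
  roof-end situation forbids the peeling); hence `∀ c ∈ S ∖ peel S, LL c ∉ roofExc (peel S) t` (`ll_notMem_roofExc`), the hypothesis `hX` of XXII.

Sources: N. Madras, G. Slade, *The Self-Avoiding Walk* (1993), §3.2, proof of Theorem 3.2.3 pp. 64–65 [MadrasSlade1993]; I. Jensen, J. Phys.: Conf. Ser. 42 (2006)
163 [Jensen2006HoneycombPolygons].  Label (lane): LANE INFRASTRUCTURE; nothing new in writing.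
-/

open Finset Literature.Probability.LatticeModels

namespace Literature.Probability.RandomPlanarGeometry.SAW

namespace HexCell

/-! ### The 3-chain and its image -/

/-- The only host of the 3-chain `{p, UR p, UR² p}` is its top. [cite: MadrasSlade1993, §3.2 (proof of Theorem 3.2.3)] -/
theorem eq_top_of_isHost_chain3 {p h : Cell} (hh : IsHost ({UR (UR p), UR p, p} : Finset Cell) h) : h = UR (UR p) := by
  obtain ⟨x, y⟩ := p
  obtain ⟨hmem, hR, hUL, htop⟩ := hh
  simp only [mem_insert, mem_singleton] at hmem
  rcases hmem with rfl | rfl | rfl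
  · rfl
  · exfalso
    have := htop (UR (UR (x, y))) (by simp)
    simp only [UR_fst, UR_snd] at this; omega
  · exfalso
    have := htop (UR (UR (x, y))) (by simp)
    simp only [UR_fst, UR_snd] at this; omega

/-- ★ **Port invariant of `F₂`** over the base `C₂`. [cite: MadrasSlade1993, §3.2 (proof of Theorem 3.2.3)] -/
theorem portInv_F2 {p : Cell} (hp : Even (p.1 + p.2)) :
    PortInv ∅ ({UR (UR p), UR p, p} : Finset Cell) ({UL (UR p), UR p, R p, p} : Finset Cell) (fun _ => UR (UL (UR p))) := by
  obtain ⟨x, y⟩ := p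
  have hpar : ∀ d : Cell, d ∈ ({UR (UR (x, y)), UR (x, y), (x, y)} : Finset Cell) ∨ d ∈ ({UL (UR (x, y)), UR (x, y), R (x, y), (x, y)} : Finset Cell) →
      Even (d.1 + d.2) := by
    intro d hd
    simp only [mem_insert, mem_singleton] at hd
    rw [Int.even_iff] at hp ⊢
    rcases hd with (rfl | rfl | rfl) | (rfl | rfl | rfl | rfl) <;> simp <;> omega
  have hrows : ∀ d ∈ ({UL (UR (x, y)), UR (x, y), R (x, y), (x, y)} : Finset Cell), d.2 ≤ y + 2 ∧ d.1 ≤ x + 2 := by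
    intro d hd; simp only [mem_insert, mem_singleton] at hd
    rcases hd with rfl | rfl | rfl | rfl <;> simp
  refine ⟨fun d hd => hpar d (Or.inl hd), fun d hd => hpar d (Or.inr hd), ?_, ?_, ?_, ?_, ?_⟩
  · intro h hh _; rw [Int.even_iff] at hp ⊢; simp; omega
  · intro h hh _ j hm
    have := (hrows _ hm).1; simp [urIter] at this; omega
  · intro h hh _; exact (card_contacts_portF2 (x, y)).2
  · intro h hh _ j hj c hc hn
    have := (hrows _ hc).1
    simp only [mem_nbrs_iff, urIter, UR_fst, UR_snd, UL_fst, UL_snd] at hn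
    rcases hn with e | e | e | e | e | e <;> (have := congrArg Prod.snd e; simp at this; omega)
  · intro h h' hh _ hh' _ hne
    exact absurd ((eq_top_of_isHost_chain3 hh).trans (eq_top_of_isHost_chain3 hh').symm) hne

/-! ### `bdry F₂` is a polygon when `bdry C₂` is -/

/-- ★ **`F₂` has a polygonal boundary when `C₂` has**: remove the top spike `UR² p`, insert `R p` (contacts `UL, L`), insert `UL (UR p)` (contact `LR`).
[cite: MadrasSlade1993, §3.2, proof of Theorem 3.2.3 pp. 64–65] -/
theorem isPolygon_bdry_F2 {p : Cell} (hp : Even (p.1 + p.2)) (hP : IsPolygon brickWallGraph (bdry ({UR (UR p), UR p, p} : Finset Cell))) :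
    IsPolygon brickWallGraph (bdry ({UL (UR p), UR p, R p, p} : Finset Cell)) := by
  obtain ⟨x, y⟩ := p
  rw [Int.even_iff] at hp
  -- bricks
  have hb3 : IsBrickSet ({UR (UR (x, y)), UR (x, y), (x, y)} : Finset Cell) := by
    intro d hd; simp only [mem_insert, mem_singleton] at hd
    rw [Int.even_iff]; rcases hd with rfl | rfl | rfl <;> simp <;> omega
  have hb2 : IsBrickSet ({UR (x, y), (x, y)} : Finset Cell) := fun d hd => hb3 d (by simp only [mem_insert, mem_singleton] at hd ⊢; tauto)
  have hb3' : IsBrickSet (insert (R (x, y)) ({UR (x, y), (x, y)} : Finset Cell)) := by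
    intro d hd
    rcases mem_insert.1 hd with rfl | hd
    · rw [Int.even_iff]; simp; omega
    · exact hb2 d hd
  -- step 1: peel the top spike
  have h1 : IsPolygon brickWallGraph (bdry ({UR (x, y), (x, y)} : Finset Cell)) := by
    have e : ({UR (UR (x, y)), UR (x, y), (x, y)} : Finset Cell).erase (UR (UR (x, y))) = {UR (x, y), (x, y)} := by
      rw [erase_insert]; norm_num [Prod.ext_iff]; omega
    rw [← e]
    refine isPolygon_bdry_erase hb3 (by simp) hP (by rw [perim_chain3]; norm_num) (a := 0) ?_
    intro i hi
    interval_cases i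
    · rw [show nbrDir (UR (UR (x, y))) (0 + 0) = LL (UR (UR (x, y))) from rfl]
      norm_num [Prod.ext_iff]
    · rw [show nbrDir (UR (UR (x, y))) (0 + 1) = LR (UR (UR (x, y))) from rfl]
      norm_num [Prod.ext_iff]; omega
    · rw [show nbrDir (UR (UR (x, y))) (0 + 2) = R (UR (UR (x, y))) from rfl]
      norm_num [Prod.ext_iff]; omega
    · rw [show nbrDir (UR (UR (x, y))) (0 + 3) = UR (UR (UR (x, y))) from rfl]
      norm_num [Prod.ext_iff]; omega
    · rw [show nbrDir (UR (UR (x, y))) (0 + 4) = UL (UR (UR (x, y))) from rfl]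
      norm_num [Prod.ext_iff]; omega
    · rw [show nbrDir (UR (UR (x, y))) (0 + 5) = L (UR (UR (x, y))) from rfl]
      norm_num [Prod.ext_iff]; omega
  -- step 2: insert `R p` with contact arc {UL, L} (directions 4, 5)
  have h2 : IsPolygon brickWallGraph (bdry (insert (R (x, y)) ({UR (x, y), (x, y)} : Finset Cell))) := by
    refine isPolygon_bdry_insert hb2 (by rw [Int.even_iff]; simp; omega) (by norm_num [Prod.ext_iff]) h1 (a := 4) (m := 2) (by norm_num) (by norm_num)
      (by rw [← card_bdry hb2]; have := three_le_card_of_isPolygon h1; omega) ?_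
    intro i hi
    interval_cases i
    · rw [show nbrDir (R (x, y)) (4 + 0) = UL (R (x, y)) from rfl]
      norm_num [Prod.ext_iff]; omega
    · rw [show nbrDir (R (x, y)) (4 + 1) = L (R (x, y)) from rfl]
      norm_num [Prod.ext_iff]
    · rw [show nbrDir (R (x, y)) (4 + 2) = LL (R (x, y)) from rfl]
      norm_num [Prod.ext_iff]; omega
    · rw [show nbrDir (R (x, y)) (4 + 3) = LR (R (x, y)) from rfl]
      norm_num [Prod.ext_iff]
    · rw [show nbrDir (R (x, y)) (4 + 4) = R (R (x, y)) from rfl]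
      norm_num [Prod.ext_iff]; omega
    · rw [show nbrDir (R (x, y)) (4 + 5) = UR (R (x, y)) from rfl]
      norm_num [Prod.ext_iff]
  -- step 3: insert `UL (UR p)` with contact arc {LR} (direction 1)
  have h3 : IsPolygon brickWallGraph (bdry (insert (UL (UR (x, y))) (insert (R (x, y)) ({UR (x, y), (x, y)} : Finset Cell)))) := by
    refine isPolygon_bdry_insert hb3' (by rw [Int.even_iff]; simp; omega) (by norm_num [Prod.ext_iff]; omega) h2 (a := 1) (m := 1) le_rfl (by norm_num)
      (by rw [← card_bdry hb3']; have := three_le_card_of_isPolygon h2; omega) ?_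
    intro i hi
    interval_cases i
    · rw [show nbrDir (UL (UR (x, y))) (1 + 0) = LR (UL (UR (x, y))) from rfl]
      norm_num [Prod.ext_iff]
    · rw [show nbrDir (UL (UR (x, y))) (1 + 1) = R (UL (UR (x, y))) from rfl]
      norm_num [Prod.ext_iff]; omega
    · rw [show nbrDir (UL (UR (x, y))) (1 + 2) = UR (UL (UR (x, y))) from rfl]
      norm_num [Prod.ext_iff]; omega
    · rw [show nbrDir (UL (UR (x, y))) (1 + 3) = UL (UL (UR (x, y))) from rfl]
      norm_num [Prod.ext_iff]; omega
    · rw [show nbrDir (UL (UR (x, y))) (1 + 4) = L (UL (UR (x, y))) from rfl]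
      norm_num [Prod.ext_iff]; omega
    · rw [show nbrDir (UL (UR (x, y))) (1 + 5) = LL (UL (UR (x, y))) from rfl]
      norm_num [Prod.ext_iff]; omega
  rw [insert_comm (UR (x, y)) (R (x, y))]
  exact h3

/-! ### LEMMA X: the exceptional host of a type-R base never carries a spike -/


/-- ★ **LEMMA X.**  If `peel S` is of type R at its top `t` (`L t ∉ peel S`, run length `k ≥ 2`), the spot `UR e_{k−1}` over the last run hexagon is not in
`S`.  (Induction along the peeling: were it the peeled top `m`, every other peeled hexagon would lie above `m` — XII's sticks stand on hosts of the base, on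
the top row or beyond the run (III, VIII) — so the rest is the base itself, in the roof-end situation, which is not peelable.)
[cite: MadrasSlade1993, §3.2 (proof of Theorem 3.2.3)] -/
theorem ur_lastRun_notMem {S : Finset Cell} {t : Cell} (hS : IsBrickSet S) (ht : IsLexmax (peel S) t) (hL : L t ∉ peel S)
    (hk : 2 ≤ runLen (peel S) t) : UR (runCell t (runLen (peel S) t - 1)) ∉ S := by
  classical
  -- fix the base and argue for every `S'` peeling to it
  suffices key : ∀ S' : Finset Cell, IsBrickSet S' → peel S' = peel S → UR (runCell t (runLen (peel S) t - 1)) ∉ S' from key S hS rfl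
  intro S'
  induction S' using Finset.strongInduction with
  | H S' ih =>
    intro hS' hpeel
    set B := peel S with hB
    set k := runLen B t with hkdef
    set a := UR (runCell t (k - 1)) with ha
    have hBb : IsBrickSet B := fun c hc => hS c (peel_subset S hc)
    have hrun : ∀ i < k, runCell t i ∈ B := fun i hi => runCell_mem_of_lt_runLen hi
    have hend : runCell t k ∉ B := runCell_runLen_notMem B t
    -- `a = (t.x + 2k, t.y)` lies on the top row right of `t`, hence outside `B`
    have ha1 : a.1 = t.1 + 2 * (k : ℤ) ∧ a.2 = t.2 := by
      simp only [ha, UR_fst, UR_snd, runCell_fst, runCell_snd]; constructor <;> omega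
    have haB : a ∉ B := by
      refine ht.notMem_of_right ha1.2 ?_
      rw [ha1.1]
      have hk1 : (1 : ℤ) ≤ (k : ℤ) := by exact_mod_cast le_trans (by norm_num) hk
      omega
    by_cases hp : ∃ m, Peelable S' m
    · obtain ⟨m, hm⟩ := hp
      have hpe : peel (S'.erase m) = B := by rw [← peel_eq_peel_erase hm]; exact hpeel
      have hnot : a ∉ S'.erase m := ih _ (erase_ssubset hm.mem) (fun c hc => hS' c (mem_of_mem_erase hc)) hpe
      intro haS
      by_cases ham : m = a
      swap
      · exact hnot (mem_erase.2 ⟨Ne.symm ham, haS⟩)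
      subst ham
      -- the rest `S'.erase a` is exactly the base `B`
      have hTB : S'.erase a = B := by
        refine Subset.antisymm ?_ (by rw [← hpe]; exact peel_subset _)
        intro c hc
        by_contra hcB
        have hcT : c ∈ S'.erase a \ peel (S'.erase a) := by rw [hpe]; exact mem_sdiff.2 ⟨hc, hcB⟩
        obtain ⟨h, i, hh, hi, hci, hseg⟩ := exists_host_stick_of_mem_sdiff_peel hcT
        rw [hpe] at hh
        have hle := hm.1.1.2 c (mem_of_mem_erase hc)
        have hcm : c ≠ a := (mem_erase.1 hc).1
        rcases hh.row_cases hBb ht with ⟨hrow, -, -⟩ | ⟨hrow, -⟩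
        · -- a stick on a top-row host lies above the top row
          rw [← hci] at hle; simp only [urIter] at hle; omega
        · by_cases hex : ∃ j < k, h = runCell t j
          · obtain ⟨j, hj, rfl⟩ := hex
            have hj' : j = k - 1 := by
              by_contra hne
              apply hh.2.1
              have e : R (runCell t j) = runCell t (j + 1) := Prod.ext (by simp only [R_fst, runCell_fst]; push_cast; ring) rfl
              rw [e]; exact hrun _ (by omega)
            have h1 := hseg 1 le_rfl hi
            have e1 : urIter (runCell t j) 1 = a := by rw [hj', urIter_succ, urIter_zero, ha]
            rw [e1] at h1
            exact (notMem_erase a S') (mem_sdiff.1 h1).1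
          · push Not at hex
            have hfar := hh.lowRow_ge_of_run hBb ht hrun hend hrow hex
            rw [← hci] at hle; simp only [urIter] at hle; omega
      -- so removing `a` was the roof-end situation: not peelable
      apply hm.2.1
      rw [hTB, show LL a = runCell t (k - 1) by rw [ha]; ext <;> simp]
      exact ⟨t, k, ht, hL, hk, hrun, hend, rfl⟩
    · rw [peel_eq_self hp] at hpeel
      rw [hpeel]; exact haB

/-- Consequently, for a type-R base, no peeled hexagon stands on the exceptional host. [cite: MadrasSlade1993, §3.2 (proof of Theorem 3.2.3)] -/
theorem ll_ne_lastRun_of_mem_sdiff_peel {S : Finset Cell} {t : Cell} (hS : IsBrickSet S) (ht : IsLexmax (peel S) t) (hL : L t ∉ peel S)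
    (hk : 2 ≤ runLen (peel S) t) {c : Cell} (hc : c ∈ S \ peel S) : LL c ≠ runCell t (runLen (peel S) t - 1) := by
  intro e
  apply ur_lastRun_notMem hS ht hL hk
  have : UR (LL c) = c := by ext <;> simp
  rw [← e, this]
  exact (mem_sdiff.1 hc).1

end HexCell

end Literature.Probability.RandomPlanarGeometry.SAW
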